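/-
Origin: expansion seat `planner-pub-hodgecm-toy-g2-0`, handover #15 2026-08-18T08:00:36Z (`HOME/pub-hodgecm-toy-g2/lean/ToyG2/EllType.lean`, md5 8030af48, 155 lines);
landed by the gen-7 packager in gate run 26 as `HodgeCM/Model/ToyG2/EllType.lean` (import ^import ToyG2\.→import HodgeCM.Model.ToyG2. ×2).
-/
/-
# HodgeCM.Model.ToyG2.EllType — the block period form has Hodge type (2,2)

Generation 2 of the `pub-hodgecm-toy` lineage (seat `planner-pub-hodgecm-toy-g2-0`), file E.ii of the
programme in `pub-hodgecm-toy-g2/DESIGN.md` §8.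

Main results, for the block `PP L Θ` with a Riemann system `ξ` (`ξ̄ᵢ = -ξᵢ`) and a quadruple of CM types
`Θ` satisfying the pair-sum identity `PairSum Θ`:

* `cnt_eq_two_of_baseC_ell_ne_zero` : an eigenvector monomial `e_g` on which `ℓ_ℂ` does not vanish has
  exactly two holomorphic indices;
* `baseC_ell_comp_wt` : `ℓ_ℂ ∘ wt z = z² • ℓ_ℂ` for the Hodge weight operator `wt z` of
  `HodgeCM.Model.ToyG2.HodgeWeight`, i.e. `ℓ` is a Hodge class of type `(2,2)` in `(⋀⁴ H¹)^∨`.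

The proof sorts the slot sequence of `g` (`Tuple.sort`), classifies monotone slot sequences
(`mono4_cases`, by `decide`) and uses the value table of `EigenForms.lean`: in the pattern `a a b b` the
characters pair up as conjugates inside each slot (one holomorphic index per pair, by the CM-type axiom),
in the pattern `0 1 2 3` they are `θ, θ, θ̄, θ̄` and the count is `2` by `PairSum`; all other patterns vanish.
-/
import Mathlib
import Summits.HodgeConjecture.HodgeCM.Model.ToyG2.EigenForms_2
import Summits.HodgeConjecture.HodgeCM.Model.ToyG2.HodgeWeight

/-! PORT of `HodgeCM/Model/ToyG2/EllType.lean` (HodgeCMPerL run 82) — verbatim mechanical port; provenance in the PORT header line. -/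

open scoped TensorProduct ComplexConjugate
open HodgeCM.Toy HodgeCM.Toy.CMPresentation exteriorPower NumberField.ComplexEmbedding
open Literature.AlgebraicGeometry.Motives
open Literature.AlgebraicGeometry.ShimuraVarieties (conjRingHomK)

namespace HodgeCM.ToyG2

noncomputable section

set_option synthInstance.maxSize 1024 in
set_option synthInstance.maxHeartbeats 200000 in
/-- classification of monotone slot sequences of length four: strictly increasing, of pattern
`a a b b` with `a < b`, or satisfying the vanishing criterion of `ell_emb_eq_zero` -/
theorem mono4_cases : ∀ x₀ x₁ x₂ x₃ : Fin 4, x₀ ≤ x₁ → x₁ ≤ x₂ → x₂ ≤ x₃ →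
    (x₀ = 0 ∧ x₁ = 1 ∧ x₂ = 2 ∧ x₃ = 3) ∨ (x₀ = x₁ ∧ x₂ = x₃ ∧ x₁ < x₂) ∨
    ((∀ a b : Fin 4, a ≠ b →
        (Finset.univ.filter fun k => ![x₀, x₁, x₂, x₃] k = a).card < 2 ∨
        (Finset.univ.filter fun k => ![x₀, x₁, x₂, x₃] k = b).card < 2) ∧
      ∃ k₀ : Fin 4, ∀ k : Fin 4, ![x₀, x₁, x₂, x₃] k ≠ k₀) := by
  decide

section Block

variable (L : CMField) (Θ : Fin 4 → CMType L) (ξ : Fin 4 → L) (d t : ℚ)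

variable {ξ} in
/-- the monotone case -/
theorem cnt_eq_two_of_monotone (hξ : ∀ i, conjRingHomK L (ξ i) = -ξ i) (hps : PairSum Θ)
    (s : Fin 4 → Fin 4) (τ : Fin 4 → (FK L →+* ℂ)) (hs : Monotone s)
    (h : baseC (PP L Θ) (ellLin L Θ ξ d t) ((PP L Θ).mono 4 (fun j => ix L Θ (τ j) (s j))) ≠ 0) :
    (PP L Θ).cnt (fun j => ix L Θ (τ j) (s j)) = 2 := by
  classical
  rcases mono4_cases (s 0) (s 1) (s 2) (s 3) (hs (by decide)) (hs (by decide)) (hs (by decide))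
    with ⟨h0, h1, h2, h3⟩ | ⟨h01, h23, hlt⟩ | ⟨hE, hT⟩
  · -- pattern `0 1 2 3`
    have hs' : (fun j => ix L Θ (τ j) (s j)) = fun j => ix L Θ (τ j) j := by
      funext j
      fin_cases j
      · exact congrArg _ h0
      · exact congrArg _ h1
      · exact congrArg _ h2
      · exact congrArg _ h3
    rw [hs'] at h ⊢
    rw [baseC_ell_mono_sorted] at h
    have hc : τ 0 = τ 1 ∧ conjugate (τ 0) = τ 2 ∧ conjugate (τ 0) = τ 3 := by
      by_contra hc
      exact h (by rw [if_neg hc, mul_zero])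
    obtain ⟨e1, e2, e3⟩ := hc
    have hp := hps ((τ 0).comp (eK L : L →+* FK L))
    simp only [ind] at hp
    rw [Obj.cnt_eq_card_filter, Finset.card_filter, Fin.sum_univ_four]
    simp only [hol_ix, ← e1, ← e2, ← e3, conjugate_comp_mem_iff]
    by_cases a0 : (τ 0).comp (eK L : L →+* FK L) ∈ (Θ 0).1 <;>
    by_cases a1 : (τ 0).comp (eK L : L →+* FK L) ∈ (Θ 1).1 <;>
    by_cases a2 : (τ 0).comp (eK L : L →+* FK L) ∈ (Θ 2).1 <;>
    by_cases a3 : (τ 0).comp (eK L : L →+* FK L) ∈ (Θ 3).1 <;>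
    simp [a0, a1, a2, a3] at hp ⊢
  · -- pattern `a a b b`
    have hlt' : s 0 < s 2 := by rw [h01]; exact hlt
    have hs' : (fun j => ix L Θ (τ j) (s j)) = fun j => ix L Θ (τ j) (![s 0, s 0, s 2, s 2] j) := by
      funext j
      fin_cases j
      · rfl
      · exact congrArg _ h01.symm
      · rfl
      · exact congrArg _ h23.symm
    rw [hs'] at h ⊢
    rw [baseC_ell_mono_pair_eq L Θ d t hξ hlt'] at h
    have c1 : τ 1 = conjugate (τ 0) := by
      by_contra hc
      exact h (by rw [if_neg hc, zero_mul, mul_zero])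
    have c3 : τ 3 = conjugate (τ 2) := by
      by_contra hc
      exact h (by rw [if_neg hc, mul_zero, mul_zero])
    rw [Obj.cnt_eq_card_filter, Finset.card_filter, Fin.sum_univ_four]
    simp only [v4_0, v4_1, v4_2, v4_3, hol_ix, c1, c3, conjugate_comp_mem_iff]
    by_cases a0 : (τ 0).comp (eK L : L →+* FK L) ∈ (Θ (s 0)).1 <;>
    by_cases a2 : (τ 2).comp (eK L : L →+* FK L) ∈ (Θ (s 2)).1 <;>
    simp [a0, a2]
  · -- vanishing patterns
    have hs4 : s = ![s 0, s 1, s 2, s 3] := by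
      funext j
      fin_cases j <;> rfl
    rw [hs4] at h
    exact absurd (baseC_ell_mono_eq_zero L Θ ξ d t _ τ hE hT) h

variable {ξ} in
/-- MAIN: an eigenvector monomial on which `ℓ_ℂ` does not vanish has exactly two holomorphic indices. -/
theorem cnt_eq_two_of_baseC_ell_ne_zero (hξ : ∀ i, conjRingHomK L (ξ i) = -ξ i) (hps : PairSum Θ)
    (g : Fin 4 → (PP L Θ).Idx)
    (h : baseC (PP L Θ) (ellLin L Θ ξ d t) ((PP L Θ).mono 4 g) ≠ 0) : (PP L Θ).cnt g = 2 := by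
  classical
  obtain ⟨s, τ, rfl⟩ := exists_ix_eq L Θ g
  let σ := Tuple.sort s
  have hmono : Monotone (s ∘ σ) := Tuple.monotone_sort s
  have h' : baseC (PP L Θ) (ellLin L Θ ξ d t)
      ((PP L Θ).mono 4 (fun j => ix L Θ ((τ ∘ σ) j) ((s ∘ σ) j))) ≠ 0 := by
    have hm : (PP L Θ).mono 4 (fun j => ix L Θ ((τ ∘ σ) j) ((s ∘ σ) j))
        = Equiv.Perm.sign σ • (PP L Θ).mono 4 (fun j => ix L Θ (τ j) (s j)) :=
      mono_comp_perm (PP L Θ) 4 (fun j => ix L Θ (τ j) (s j)) σ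
    rw [hm, map_zsmul_unit, Units.smul_def, zsmul_eq_mul]
    exact mul_ne_zero (Int.cast_ne_zero.mpr (Units.ne_zero _)) h
  have hc := cnt_eq_two_of_monotone L Θ d t hξ hps (s ∘ σ) (τ ∘ σ) hmono h'
  rwa [show (fun j => ix L Θ ((τ ∘ σ) j) ((s ∘ σ) j)) = (fun j => ix L Θ (τ j) (s j)) ∘ σ from rfl,
    cnt_comp_perm] at hc

variable {ξ} in
/-- **`ℓ` has Hodge type `(2,2)`**: `ℓ_ℂ ∘ wt z = z² • ℓ_ℂ` on `⋀⁴_ℂ (ℂ ⊗ H¹)`. -/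
theorem baseC_ell_comp_wt (hξ : ∀ i, conjRingHomK L (ξ i) = -ξ i) (hps : PairSum Θ) (z : ℂ) :
    baseC (PP L Θ) (ellLin L Θ ξ d t) ∘ₗ (PP L Θ).wt z 4
      = (z ^ 2) • baseC (PP L Θ) (ellLin L Θ ξ d t) := by
  classical
  refine ((PP L Θ).eB.exteriorPower 4).ext fun S => ?_
  rw [LinearMap.comp_apply, LinearMap.smul_apply, basis_eq_mono, Obj.wt_mono, map_smul, smul_eq_mul,
    smul_eq_mul]
  by_cases h0 : baseC (PP L Θ) (ellLin L Θ ξ d t) ((PP L Θ).mono 4 (enum (PP L Θ) S)) = 0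
  · rw [h0, mul_zero, mul_zero]
  · rw [cnt_eq_two_of_baseC_ell_ne_zero L Θ d t hξ hps _ h0]

/-- the same, pointwise -/
theorem baseC_ell_wt (hξ : ∀ i, conjRingHomK L (ξ i) = -ξ i) (hps : PairSum Θ) (z : ℂ)
    (x : ⋀[ℂ]^4 (PP L Θ).LC) :
    baseC (PP L Θ) (ellLin L Θ ξ d t) ((PP L Θ).wt z 4 x)
      = z ^ 2 * baseC (PP L Θ) (ellLin L Θ ξ d t) x := by
  have h := congrArg (fun f => f x) (baseC_ell_comp_wt L Θ d t hξ hps z)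
  simpa using h

end Block

end

end HodgeCM.ToyG2
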